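import Mathlib
import Literature.NumberTheory.MahlerMeasure.DobrowolskiBound
import Summits.Ventures.DiscreteObjects.Mahler.DobrowolskiCorollaries

/-!
# Discharge of the Literature named fact `DobrowolskiHeightBound` (venture `DiscreteObjects`, target L)

Cell `pub-namedobj`, seat `pub-namedobj-mahler-g27`. Framing: lottery ticket; floor = certified bounds/negative ranges.

`Literature.NumberTheory.MahlerMeasure.DobrowolskiHeightBound` — [cite: BombieriGubler2001, Theorem 4.4.1] in polynomial
form: an absolute `c > 0` with `log M(f) ≥ c (log log 3d / log 3d)³` for every irreducible `f ∈ ℤ[X]` with `M(f) > 1`,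
`d = deg f` — HOLDS in the kernel (`dobrowolskiHeightBound_holds`), by the uniform per-factor bound
`DobrowolskiCorollaries.exists_log_measure_ge_shape` (Dobrowolski's theorem `DobrowolskiTheorem.dobrowolski` for degrees
`≥ 16`, the weak bound `1 + 1/(22d)` below) applied with `D = 3d`.  The companion fact `DobrowolskiMeasureBound`
(McKee–Smyth's `2 - ε`) is NOT discharged: its constant needs the Prime Number Theorem.  No new mathematics.
-/

namespace Summit.Ventures.DiscreteObjects.Mahler

open Polynomial

/-- **[BombieriGubler2001, Theorem 4.4.1] holds**: Dobrowolski's theorem in the absolute-constant height form,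
discharging the Literature named fact `DobrowolskiHeightBound`. -/
theorem dobrowolskiHeightBound_holds : Literature.NumberTheory.MahlerMeasure.DobrowolskiHeightBound := by
  obtain ⟨c, hcpos, hc⟩ := exists_log_measure_ge_shape
  refine ⟨c, hcpos, fun f hirr hM => ?_⟩
  have h := hc f hirr hM (3 * f.natDegree) (by omega)
  push_cast at h
  exact h

end Summit.Ventures.DiscreteObjects.Mahler
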